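import Literature.NumberTheory.Automorphic.GodementJacquetBruhatWeight
import Literature.NumberTheory.Automorphic.GLnZetaKernel
import Literature.NumberTheory.Automorphic.AutomorphicForms
import HarnessLib

/-!
# Absorbing the central integral: from `∫ β(y₀) F([y₀]) ∫_{A_G} σ(a y₀⁻¹)` to `∫ w(ỹ) F([ỹ⁻¹]) σ(ỹ)`

Topic `NumberTheory/Automorphic`; namespace `Literature.NumberTheory.Automorphic`. Proof file
(one theorem). In the reflection formula for the truncated Godement–Jacquet zeta integral
(`gjZeta_restrict_compl_sub_dual_eq_integral_gjSingDefect`) the singular defect enters through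
`∫_G β(y₀) φ([y₀]) (κ ∫_{A_G} S(x₀, y₀, a) dα) dν(y₀)` with `S` a function of `a y₀⁻¹`.
`integral_bruhat_mul_integral_center_eq` rewrites, for any Borel `σ` on `G = GL_n(𝔸_K)` and `F`
on `G / H` (`H = A_G GL_n(K)`) with `y ↦ F([y])` continuous, under absolute convergence,
`∫_G β(y₀) F([y₀]) (∫_{A_G} σ(a y₀⁻¹) dα) dν(y₀) = κ⁻¹ ∫_G w(ỹ) F([ỹ⁻¹]) σ(ỹ) dν(ỹ)`
with the covering weight `w = gjWeight κ α β` of `GodementJacquetBruhatWeight` — Fubini, the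
substitution `y₀ ↦ y₀ a` (right invariance of `ν`), Fubini, and `y₀ ↦ y₀⁻¹` (unimodularity).
This is the passage "`∫_{Z_𝔸 G_K \ G_𝔸} … = ∫_{G_K \ G_𝔸} …`" of Godement–Jacquet (1972), §12,
in the tree's formalism of Bruhat functions and covering weights on the group.

## References

* R. Godement, H. Jacquet, *Zeta functions of simple algebras*, LNM 260 (1972), §12
  [GodementJacquetLNM260].
-/

noncomputable section

open MeasureTheory Measure Set Filter Topology IsDedekindDomain NumberField
open Literature.MeasureTheory.Group
open scoped ENNReal NNReal

namespace Literature.NumberTheory.Automorphic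

variable {n : ℕ} {K : Type} [Field K] [NumberField K]

attribute [local instance] adelicBorel borelSpace_adelic locallyCompactSpace_adelic
  secondCountableTopology_gl_adelic measurableSpaceQuotient borelSpaceQuotient

variable (ν : Measure (AdelicGroupData.gl n K).Adelic) [ν.IsHaarMeasure]

/-- **Absorbing the `A_G`-integral into a covering weight.** For a Bruhat function `β` of
`H = A_G GL_n(K)` with `ρ_H ≅ κ (α ⊗ #)`, `F` on the automorphic quotient with `y ↦ F([y])`
continuous, and `σ` Borel on `G` with `∫_G β(y₀) |F([y₀])| ∫_{A_G} |σ(a y₀⁻¹)| dα dν(y₀) < ∞`: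
`∫_G β(y₀) F([y₀]) (∫_{A_G} σ(a y₀⁻¹) dα) dν(y₀) = κ⁻¹ ∫_G w(ỹ) F([ỹ⁻¹]) σ(ỹ) dν(ỹ)`,
`w = gjWeight κ α β` (Fubini, `y₀ ↦ y₀ a`, Fubini, `y₀ ↦ y₀⁻¹`; `GL_n(𝔸_K)` is unimodular). This
turns the `y₀`-integral of the singular defect of the Godement–Jacquet reflection formula into an
integral against the `GL_n(K)`-covering weight `w`, ready for unfolding (Godement–Jacquet (1972),
§12). [folklore] -/
theorem integral_bruhat_mul_integral_center_eq
    {ρ : Measure (AdelicGroupData.gl n K).quotientSubgroup}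
    {α : Measure (AdelicGroupData.gl n K).center'} [α.IsHaarMeasure] {κ : ℝ≥0} (hκ0 : κ ≠ 0)
    {β : (AdelicGroupData.gl n K).Adelic → ℝ}
    (hβ : IsBruhatFunction (AdelicGroupData.gl n K).quotientSubgroup ρ β)
    {F : (AdelicGroupData.gl n K).Adelic ⧸ (AdelicGroupData.gl n K).quotientSubgroup → ℂ}
    (hFc : Continuous fun y : (AdelicGroupData.gl n K).Adelic => F (QuotientGroup.mk y))
    {σ : (AdelicGroupData.gl n K).Adelic → ℂ} (hσm : Measurable σ)
    (hint : ∫⁻ y₀, ENNReal.ofReal (β y₀) * ((‖F (QuotientGroup.mk y₀)‖ₑ : ℝ≥0∞) *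
      ∫⁻ a : (AdelicGroupData.gl n K).center', ‖σ ((a : (AdelicGroupData.gl n K).Adelic) * y₀⁻¹)‖ₑ ∂α) ∂ν < ⊤) :
    ∫ y₀, (β y₀ : ℂ) * (F (QuotientGroup.mk y₀) *
        ∫ a : (AdelicGroupData.gl n K).center', σ ((a : (AdelicGroupData.gl n K).Adelic) * y₀⁻¹) ∂α) ∂ν =
      ((κ : ℝ) : ℂ)⁻¹ * ∫ y, ((gjWeight κ α β y).toReal : ℂ) *
        (invQuot (AdelicGroupData.gl n K) F y * σ y) ∂ν := by
  haveI : ν.IsMulRightInvariant := GLn.isMulRightInvariant_of_isHaarMeasure_adelic_holds n K ν inferInstance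
  haveI : ν.IsInvInvariant := isInvInvariant_of_isHaarMeasure_gl n K ν
  -- the integrand on `G × A_G`
  set f : (AdelicGroupData.gl n K).Adelic → (AdelicGroupData.gl n K).center' → ℂ :=
    fun y₀ a => (β y₀ : ℂ) * (F (QuotientGroup.mk y₀) * σ ((a : (AdelicGroupData.gl n K).Adelic) * y₀⁻¹)) with hf
  have hβm : Measurable fun y : (AdelicGroupData.gl n K).Adelic => (β y : ℂ) :=
    (Complex.continuous_ofReal.comp hβ.continuous).measurable
  have hact : Measurable fun p : (AdelicGroupData.gl n K).Adelic × (AdelicGroupData.gl n K).center' =>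
      (p.2 : (AdelicGroupData.gl n K).Adelic) * p.1⁻¹ :=
    ((continuous_subtype_val.comp continuous_snd).mul continuous_fst.inv).measurable
  have hfm : Measurable (Function.uncurry f) :=
    (hβm.comp measurable_fst).mul ((hFc.measurable.comp measurable_fst).mul (hσm.comp hact))
  -- integrability on the product
  have hnorm : ∀ y₀ a, (‖Function.uncurry f (y₀, a)‖ₑ : ℝ≥0∞) = ENNReal.ofReal (β y₀) *
      ((‖F (QuotientGroup.mk y₀)‖ₑ : ℝ≥0∞) * ‖σ ((a : (AdelicGroupData.gl n K).Adelic) * y₀⁻¹)‖ₑ) := by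
    intro y₀ a
    simp only [Function.uncurry_apply_pair, hf, enorm_mul]
    rw [← ofReal_norm (β y₀ : ℂ), Complex.norm_real, Real.norm_of_nonneg (hβ.nonneg _)]
  have hσa : ∀ y₀ : (AdelicGroupData.gl n K).Adelic, Measurable fun a : (AdelicGroupData.gl n K).center' =>
      (‖σ ((a : (AdelicGroupData.gl n K).Adelic) * y₀⁻¹)‖ₑ : ℝ≥0∞) := fun y₀ =>
    (hσm.comp ((continuous_subtype_val.mul continuous_const).measurable)).enorm
  have hlin : ∫⁻ z, ‖Function.uncurry f z‖ₑ ∂(ν.prod α) = ∫⁻ y₀, ENNReal.ofReal (β y₀) *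
      ((‖F (QuotientGroup.mk y₀)‖ₑ : ℝ≥0∞) *
        ∫⁻ a : (AdelicGroupData.gl n K).center', ‖σ ((a : (AdelicGroupData.gl n K).Adelic) * y₀⁻¹)‖ₑ ∂α) ∂ν := by
    rw [lintegral_prod _ hfm.enorm.aemeasurable]
    refine lintegral_congr fun y₀ => ?_
    simp_rw [hnorm]
    rw [lintegral_const_mul _ ((hσa y₀).const_mul _), lintegral_const_mul _ (hσa y₀)]
  have hfi : Integrable (Function.uncurry f) (ν.prod α) := by
    refine ⟨hfm.aestronglyMeasurable, ?_⟩
    rw [HasFiniteIntegral, hlin]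
    exact hint
  -- Step 1: the inner `A_G`-integral as an iterated integral
  have h1 : ∫ y₀, (β y₀ : ℂ) * (F (QuotientGroup.mk y₀) *
      ∫ a : (AdelicGroupData.gl n K).center', σ ((a : (AdelicGroupData.gl n K).Adelic) * y₀⁻¹) ∂α) ∂ν =
      ∫ y₀, ∫ a, f y₀ a ∂α ∂ν := by
    refine integral_congr_ae (Eventually.of_forall fun y₀ => ?_)
    simp only [hf]
    rw [integral_const_mul, integral_const_mul]
  -- Step 2/3: Fubini and `y₀ ↦ y₀ a`
  set g : (AdelicGroupData.gl n K).center' → (AdelicGroupData.gl n K).Adelic → ℂ :=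
    fun a y₀ => (β (y₀ * (a : (AdelicGroupData.gl n K).Adelic)) : ℂ) *
      (F (QuotientGroup.mk y₀) * σ y₀⁻¹) with hg
  have hfg : ∀ (a : (AdelicGroupData.gl n K).center') (y₀ : (AdelicGroupData.gl n K).Adelic),
      f (y₀ * (a : (AdelicGroupData.gl n K).Adelic)) a = g a y₀ := by
    intro a y₀
    simp only [hf, hg]
    have hmk : (QuotientGroup.mk (y₀ * (a : (AdelicGroupData.gl n K).Adelic)) :
        (AdelicGroupData.gl n K).Adelic ⧸ (AdelicGroupData.gl n K).quotientSubgroup) = QuotientGroup.mk y₀ :=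
      QuotientGroup.mk_mul_of_mem y₀ ((AdelicGroupData.gl n K).center'_le_quotientSubgroup a.2)
    have hinv : (a : (AdelicGroupData.gl n K).Adelic) * (y₀ * (a : (AdelicGroupData.gl n K).Adelic))⁻¹ = y₀⁻¹ := by
      rw [mul_inv_rev, mul_inv_cancel_left]
    rw [hmk, hinv]
  have h2 : ∫ y₀, ∫ a, f y₀ a ∂α ∂ν = ∫ a, ∫ y₀, g a y₀ ∂ν ∂α := by
    rw [integral_integral_swap hfi]
    refine integral_congr_ae (Eventually.of_forall fun a => ?_)
    show ∫ y₀, f y₀ a ∂ν = ∫ y₀, g a y₀ ∂ν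
    rw [← integral_mul_right_eq_self (fun y₀ => f y₀ a) (a : (AdelicGroupData.gl n K).Adelic)]
    exact integral_congr_ae (Eventually.of_forall fun y₀ => hfg a y₀)
  -- Step 4: Fubini back
  have hgm : Measurable (Function.uncurry g) := by
    have he : Measurable fun p : (AdelicGroupData.gl n K).center' × (AdelicGroupData.gl n K).Adelic =>
        (p.2 * (p.1 : (AdelicGroupData.gl n K).Adelic), p.1) :=
      ((continuous_snd.mul (continuous_subtype_val.comp continuous_fst)).prodMk continuous_fst).measurable
    have : Function.uncurry g = Function.uncurry f ∘ fun p : (AdelicGroupData.gl n K).center' × (AdelicGroupData.gl n K).Adelic =>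
        (p.2 * (p.1 : (AdelicGroupData.gl n K).Adelic), p.1) := by
      funext p
      simp only [Function.comp_apply, Function.uncurry_apply_pair]
      exact (hfg p.1 p.2).symm
    rw [this]
    exact hfm.comp he
  have hgi : Integrable (Function.uncurry g) (α.prod ν) := by
    refine ⟨hgm.aestronglyMeasurable, ?_⟩
    rw [HasFiniteIntegral, lintegral_prod _ hgm.enorm.aemeasurable]
    have h3 : ∀ a : (AdelicGroupData.gl n K).center',
        ∫⁻ y₀, ‖Function.uncurry g (a, y₀)‖ₑ ∂ν = ∫⁻ y₀, ‖Function.uncurry f (y₀, a)‖ₑ ∂ν := fun a => by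
      rw [← lintegral_mul_right_eq_self (fun y₀ => (‖Function.uncurry f (y₀, a)‖ₑ : ℝ≥0∞))
        (a : (AdelicGroupData.gl n K).Adelic)]
      refine lintegral_congr fun y₀ => ?_
      simp only [Function.uncurry_apply_pair]
      rw [hfg]
    simp_rw [h3]
    have hsw := lintegral_lintegral_swap (μ := α) (ν := ν)
      (f := fun (a : (AdelicGroupData.gl n K).center') (y₀ : (AdelicGroupData.gl n K).Adelic) =>
        (‖Function.uncurry f (y₀, a)‖ₑ : ℝ≥0∞))
      ((hfm.enorm.comp measurable_swap).aemeasurable)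
    rw [hsw, ← lintegral_prod _ hfm.enorm.aemeasurable, hlin]
    exact hint
  have h4 : ∫ a, ∫ y₀, g a y₀ ∂ν ∂α = ∫ y₀, ∫ a, g a y₀ ∂α ∂ν := integral_integral_swap hgi
  -- Step 5: the inner `A_G`-integral is `(∫ β(y₀ a) dα) · F([y₀]) σ(y₀⁻¹)`
  have h5 : ∀ y₀ : (AdelicGroupData.gl n K).Adelic, ∫ a, g a y₀ ∂α =
      ((∫ a : (AdelicGroupData.gl n K).center', β (y₀ * (a : (AdelicGroupData.gl n K).Adelic)) ∂α : ℝ) : ℂ) *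
        (F (QuotientGroup.mk y₀) * σ y₀⁻¹) := fun y₀ => by
    simp only [hg]
    rw [integral_mul_const, integral_complex_ofReal]
  simp_rw [h1, h2, h4, h5]
  -- Step 6: `y₀ ↦ y₀⁻¹`
  rw [← integral_inv_eq_self (μ := ν) (fun y₀ : (AdelicGroupData.gl n K).Adelic =>
    ((∫ a : (AdelicGroupData.gl n K).center', β (y₀ * (a : (AdelicGroupData.gl n K).Adelic)) ∂α : ℝ) : ℂ) *
      (F (QuotientGroup.mk y₀) * σ y₀⁻¹))]
  simp only [inv_inv]
  -- Step 7: `∫ β(y⁻¹ a) dα = κ⁻¹ w(y)`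
  rw [← integral_const_mul]
  refine integral_congr_ae (Eventually.of_forall fun y => ?_)
  beta_reduce
  have h7 : ((∫ a : (AdelicGroupData.gl n K).center', β (y⁻¹ * (a : (AdelicGroupData.gl n K).Adelic)) ∂α : ℝ) : ℂ) =
      ((κ : ℝ) : ℂ)⁻¹ * ((gjWeight κ α β y).toReal : ℂ) := by
    rw [toReal_gjWeight hβ.continuous hβ.nonneg]
    have hκ' : ((κ : ℝ) : ℂ) ≠ 0 := by exact_mod_cast hκ0
    push_cast
    rw [← mul_assoc, inv_mul_cancel₀ hκ', one_mul]
  rw [h7, mul_assoc]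
  rfl

end Literature.NumberTheory.Automorphic
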